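import Summits.ABC.ABC.Theorems.CuspFieldPencilGoldenFromNFPencil
import Summits.ABC.ABC.Theorems.YuMatveevShapeRatCloses
import Summits.ABC.ABC.Theorems.PlacewiseSzpiroSingleTowerSzpiroBakerSinglePlace
import Literature.Barriers.ABC.BakerMethodBoundsThreeRoutesProofs
import Literature.Barriers.ABC.BakerMethodBoundsStewartYuProofs
import Literature.Barriers.ABC.BakerMethodBoundsStewartTijdemanProofs
import HarnessLib

/-!
# STUB-IDEAS sketch · `stub_splitCuspTriple` · ideator k2 · GEN 6 — FAMILY 2 (RESHAPE):
# "constants first" — the line cut down to S/XS lemmas with EXPLICIT constants, no M-sized step left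

Crux `GoldenCuspShadow` (stmt-ABC-26026), route `CuspFieldPencil`, skeleton sha a4ca286a….
Elaboration-only sketch: every `sorry` is a PROPOSED HELPER LEMMA; the sorry-free declarations
certify that the helpers compose to the stub AND to the crux BY NAME, and that the only external
input is the KERNEL THEOREM
`Summit.ABC.ABC.Theorems.approximationBound_rat_holds : ∃ K ≥ 1, PastenApproximationBound K`.

THE LINE (unchanged mathematics = the converged "ℚ-line" of all six ideation seats):
the cusp-0 distance function `ξ₀ = −Q/w²` (`Q = u² − 11uw − w²`, `1 − ξ₀ = u(u − 11w)/w²`,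
`T₀ : w² + Q = u(u − 11w)`) is fed ONCE to `Pasten.approx_div`; p-adic clause at `p ∣ u` ⇒
`log|u| ≤ 3Θ₀Y·Σ_{p∣u} p`; archimedean clause ⇒ `log H ≤ log|u| + log 12 + Θ₀Y`; `Θ₀ ≤ K·C·R^η`;
self-improvement; cusp swap `(u,w) ↦ (w,−u)`; `min` ⇒ stub and crux.

GEN-6 RESHAPES (Family 2, prover-cost cuts; the mathematics is fixed):
* CONSTANTS FIRST.  GEN 5's two M− lemmas (`endgame_abstract`, `preRouteU`) are each recut into
  2–3 S/XS lemmas with EXPLICIT constants — and then everything on that side got PROVED here: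
  - `endgame_abstract` ⇐ B1 `selfImprove_pow` (scalar: `y ≤ M log max(e,2y) ⇒ y ≤ (8/η) M^{1+η}`)
    + B2 `pow_bookkeeping` (scalar: `(A R^η m)^{1+η} ≤ A² R^{3η} m`), `η := min ε 1 / 3`,
    `κ := (8/η)·max(A,1)²` — B1, B2 AND the endgame are PROVED (FILE B is finished).
  - `preRouteU` ⇐ G1a escape (`u = 11w`, PROVED via the harvested classification E0) + G1b generic with
    `A = log 1872 + 8KC` (PROVED from C4/T1/J3/Y1' via the generic real inequality `absorb`, PROVED).
* DECIDE THE ESCAPE.  The escape regime is the PROVED finite classification `aux_degenerate_iff`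
  (harvest, seat conj-k3 g2): E1 closed; A2 `1 − ξ₀ = u(u−11w)/w²` and E6 `ξ₀ ≠ 1` PROVED.
* HARVEST (Family 1 on our own crux directory, attributed): `exp_step`, `min_le_sqrt_mul`,
  `min_le_geom`, `radR_eq`, `crux_of_uwHalf` (seat conj-k2 g4, PROVED there) close R2 and, adapted, R1/R0;
  `sum_le_prod_of_two_le` (tree, StewartTijdeman) closes J3; C1 and T1 are PROVED compositions.
RESULT: 7 sorried helpers remain — E3 `one_lt_xy_u`, P1 `factorization_le_padicValRat_xiU`,
P2 `log_natAbs_le_of_padic`, C2 `abs_one_sub_xiU_le`, C3 `cusp0_transfer`, Y1 `logHeight₁_xiU_le`,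
T0 `rad_aux_eq` — each S/XS with a named template; the other 40 declarations are sorry-free, and the
composition to the stub (`stubSplit_holds`) and to the crux BY NAME (`goldenCuspShadow_holds`) is
kernel-checked modulo exactly those 7.
-/

set_option linter.dupNamespace false

noncomputable section

open Finset Real Height
open Literature.NumberTheory.DiophantineGeometry
open Literature.NumberTheory.DiophantineGeometry.Dioph
open Literature.NumberTheory.DiophantineGeometry.Pasten
open Literature.Barriers.ABC
open Summit.ABC.ABC.Theorems

namespace Summit.ABC.ABC.Cruxes.GoldenCuspShadow.SplitK2G6

/-! ## 0 · The stub (verbatim), the two one-cusp targets, the min-form -/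

/-- The registered stub signature `stub_splitCuspTriple`, verbatim. -/
def StubSplit : Prop :=
  ∀ ε : ℝ, 0 < ε → ∃ κ : ℝ, ∀ u w : ℤ, IsCoprime u w → u * w * (u ^ 2 - 11 * u * w - w ^ 2) ≠ 0 → Real.log (max (|(u : ℝ)|) (|(w : ℝ)|)) ≤ κ * (((UniqueFactorizationMonoid.radical (u * w * (u ^ 2 - 11 * u * w - w ^ 2))).natAbs : ℕ) : ℝ) ^ (ε : ℝ) * (((((UniqueFactorizationMonoid.radical u).natAbs : ℕ) : ℝ) * (((UniqueFactorizationMonoid.radical w).natAbs : ℕ) : ℝ)) ^ (2 / 3 : ℝ) * (((UniqueFactorizationMonoid.radical (u ^ 2 - 11 * u * w - w ^ 2)).natAbs : ℕ) : ℝ) ^ (1 / 3 : ℝ))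

/-- ONE-CUSP TARGET at the cusp `t = 0`: `log max(|u|,|w|) ≤ κ_ε · rad(uwQ)^ε · rad u`. -/
def RouteU : Prop :=
  ∀ ε : ℝ, 0 < ε → ∃ κ : ℝ, ∀ u w : ℤ, IsCoprime u w → u * w * (u ^ 2 - 11 * u * w - w ^ 2) ≠ 0 →
    Real.log (max (|(u : ℝ)|) (|(w : ℝ)|)) ≤
      κ * (((UniqueFactorizationMonoid.radical (u * w * (u ^ 2 - 11 * u * w - w ^ 2))).natAbs : ℕ) : ℝ) ^ (ε : ℝ) *
        (((UniqueFactorizationMonoid.radical u).natAbs : ℕ) : ℝ)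

/-- ONE-CUSP TARGET at the cusp `t = ∞`: `log max(|u|,|w|) ≤ κ_ε · rad(uwQ)^ε · rad w`. -/
def RouteW : Prop :=
  ∀ ε : ℝ, 0 < ε → ∃ κ : ℝ, ∀ u w : ℤ, IsCoprime u w → u * w * (u ^ 2 - 11 * u * w - w ^ 2) ≠ 0 →
    Real.log (max (|(u : ℝ)|) (|(w : ℝ)|)) ≤
      κ * (((UniqueFactorizationMonoid.radical (u * w * (u ^ 2 - 11 * u * w - w ^ 2))).natAbs : ℕ) : ℝ) ^ (ε : ℝ) *
        (((UniqueFactorizationMonoid.radical w).natAbs : ℕ) : ℝ)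

/-- The min-form (same text as GEN 2–5, as k1/k3's `MinRadBound` and as conj-k2's `UWHalf`):
`log max(|u|,|w|) ≤ κ_ε · rad(uwQ)^ε · min(rad u, rad w)`. -/
def CuspMinRadBound : Prop :=
  ∀ ε : ℝ, 0 < ε → ∃ κ : ℝ, ∀ u w : ℤ, IsCoprime u w → u * w * (u ^ 2 - 11 * u * w - w ^ 2) ≠ 0 →
    Real.log (max (|(u : ℝ)|) (|(w : ℝ)|)) ≤
      κ * (((UniqueFactorizationMonoid.radical (u * w * (u ^ 2 - 11 * u * w - w ^ 2))).natAbs : ℕ) : ℝ) ^ (ε : ℝ) *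
        min ((((UniqueFactorizationMonoid.radical u).natAbs : ℕ) : ℝ))
            ((((UniqueFactorizationMonoid.radical w).natAbs : ℕ) : ℝ))

/-! ## 1 · FILE B (pure real analysis, parallel prover): the endgame, CONSTANTS FIRST -/

/-- **B1 (PROVED; scalar self-improvement in power form).**  If `1 ≤ M`, `0 < η ≤ 1` and
`y ≤ M · log max(e, 2y)` then `y ≤ (8/η) · M^{1+η}`.
Template: tree `Literature.Barriers.ABC.le_of_le_mul_log_max hM h : y ≤ 2M log(4M)`; then
`Real.log_le_rpow_div : log(4M) ≤ (4M)^η/η`, `(4M)^η = 4^η M^η ≤ 4 M^η` (`Real.mul_rpow`,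
`Real.rpow_le_rpow_of_exponent_le` on base `4 ≥ 1` with `η ≤ 1`, `Real.rpow_one`), and
`M · M^η = M^{1+η}` (`Real.rpow_add_one'`/`Real.rpow_add` with `M > 0`, `add_comm`). -/
theorem selfImprove_pow {y M η : ℝ} (hM : 1 ≤ M) (hη : 0 < η) (hη1 : η ≤ 1)
    (h : y ≤ M * Real.log (max (Real.exp 1) (2 * y))) :
    y ≤ 8 / η * M ^ (1 + η) := by
  have hM0 : 0 < M := by linarith
  have hη0 : η ≠ 0 := hη.ne'
  have h1 := le_of_le_mul_log_max hM h
  have h2 : Real.log (4 * M) ≤ (4 * M) ^ η / η := Real.log_le_rpow_div (by linarith) hη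
  have hMη : 0 ≤ M ^ η := Real.rpow_nonneg hM0.le η
  have h3 : (4 * M) ^ η ≤ 4 * M ^ η := by
    rw [Real.mul_rpow (by norm_num) hM0.le]
    have h4η : (4 : ℝ) ^ η ≤ 4 := by
      calc (4 : ℝ) ^ η ≤ (4 : ℝ) ^ (1 : ℝ) := Real.rpow_le_rpow_of_exponent_le (by norm_num) hη1
        _ = 4 := Real.rpow_one 4
    exact mul_le_mul_of_nonneg_right h4η hMη
  have h4 : M ^ (1 + η) = M * M ^ η := by
    rw [Real.rpow_add hM0, Real.rpow_one]
  have h5 : Real.log (4 * M) ≤ 4 * M ^ η / η := by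
    calc Real.log (4 * M) ≤ (4 * M) ^ η / η := h2
      _ ≤ 4 * M ^ η / η := by gcongr
  rw [h4]
  calc y ≤ 2 * M * Real.log (4 * M) := h1
    _ ≤ 2 * M * (4 * M ^ η / η) := mul_le_mul_of_nonneg_left h5 (by linarith)
    _ = 8 / η * (M * M ^ η) := by field_simp; ring

/-- **B2 (PROVED; exponent bookkeeping).**  For `1 ≤ A`, `1 ≤ m ≤ R`, `0 < η ≤ 1`:
`(A · R^η · m)^{1+η} ≤ A² · R^{3η} · m`.
Template: `Real.mul_rpow` twice; `A^{1+η} ≤ A²` (`Real.rpow_le_rpow_of_exponent_le hA : 1+η ≤ 2`,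
`Real.rpow_natCast`/`Real.rpow_two`); `(R^η)^{1+η} = R^{η+η²}` (`Real.rpow_mul`, `R ≥ 0`);
`m^{1+η} = m · m^η ≤ m · R^η` (`Real.rpow_add_one'`, `Real.rpow_le_rpow`); `η + η² + η ≤ 3η` since
`η² ≤ η`; collect with `Real.rpow_add` (`R > 0`) and `Real.rpow_le_rpow_of_exponent_le hR`. -/
theorem pow_bookkeeping {A R m η : ℝ} (hA : 1 ≤ A) (hR : 1 ≤ R) (hm : 1 ≤ m) (hmR : m ≤ R)
    (hη : 0 < η) (hη1 : η ≤ 1) :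
    (A * R ^ η * m) ^ (1 + η) ≤ A ^ 2 * R ^ (3 * η) * m := by
  have hA0 : 0 < A := by linarith
  have hR0 : 0 < R := by linarith
  have hm0 : 0 < m := by linarith
  have hRη : 0 ≤ R ^ η := Real.rpow_nonneg hR0.le η
  rw [Real.mul_rpow (mul_nonneg hA0.le hRη) hm0.le, Real.mul_rpow hA0.le hRη]
  have e1 : A ^ (1 + η) ≤ A ^ (2 : ℝ) := Real.rpow_le_rpow_of_exponent_le hA (by linarith)
  have e1' : A ^ (1 + η) ≤ A ^ 2 := by rwa [Real.rpow_two] at e1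
  have e2 : (R ^ η) ^ (1 + η) = R ^ (η * (1 + η)) := by rw [← Real.rpow_mul hR0.le]
  have e3 : m ^ (1 + η) = m * m ^ η := by rw [Real.rpow_add hm0, Real.rpow_one]
  have e4 : m ^ η ≤ R ^ η := Real.rpow_le_rpow hm0.le hmR hη.le
  have e5 : R ^ (η * (1 + η)) * R ^ η ≤ R ^ (3 * η) := by
    rw [← Real.rpow_add hR0]
    apply Real.rpow_le_rpow_of_exponent_le hR
    nlinarith
  rw [e2, e3]
  calc A ^ (1 + η) * R ^ (η * (1 + η)) * (m * m ^ η)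
      ≤ A ^ 2 * R ^ (η * (1 + η)) * (m * R ^ η) := by gcongr
    _ = A ^ 2 * (R ^ (η * (1 + η)) * R ^ η) * m := by ring
    _ ≤ A ^ 2 * R ^ (3 * η) * m := by gcongr

/-- **ENDGAME (abstract self-improvement) — PROVED from B1 + B2.**  For a family of non-negative
reals `y i` with `1 ≤ m i ≤ R i`: if for every `η > 0` there is `A` with
`y i ≤ A · (R i)^η · m i · log max(e, 2 y i)`, then for every `ε > 0` there is `κ` with
`y i ≤ κ · (R i)^ε · m i`.  Constants: `η := min ε 1 / 3`, `κ := (8/η) · max(A,1)²`. -/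
theorem endgame_abstract {ι : Type*} {y R m : ι → ℝ}
    (_hy : ∀ i, 0 ≤ y i) (hR : ∀ i, 1 ≤ R i) (hm : ∀ i, 1 ≤ m i) (hmR : ∀ i, m i ≤ R i)
    (hpre : ∀ η : ℝ, 0 < η → ∃ A : ℝ, ∀ i,
      y i ≤ A * R i ^ η * m i * Real.log (max (Real.exp 1) (2 * y i))) :
    ∀ ε : ℝ, 0 < ε → ∃ κ : ℝ, ∀ i, y i ≤ κ * R i ^ ε * m i := by
  intro ε hε
  have hε1 : 0 < min ε 1 := lt_min hε one_pos
  set η : ℝ := min ε 1 / 3 with hη_def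
  have hη : 0 < η := by rw [hη_def]; linarith
  have hη1 : η ≤ 1 := by have := min_le_right ε 1; rw [hη_def]; linarith
  have h3η : 3 * η ≤ ε := by have := min_le_left ε 1; rw [hη_def]; linarith
  obtain ⟨A, hA⟩ := hpre η hη
  refine ⟨8 / η * (max A 1) ^ 2, fun i => ?_⟩
  have hA1 : 1 ≤ max A 1 := le_max_right _ _
  have hRi := hR i
  have hmi := hm i
  have hm0 : 0 ≤ m i := by linarith
  have hRη1 : 1 ≤ R i ^ η := Real.one_le_rpow hRi hη.le
  have hL1 : 1 ≤ Real.log (max (Real.exp 1) (2 * y i)) := one_le_log_max_exp _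
  have hM1 : 1 ≤ max A 1 * R i ^ η * m i :=
    one_le_mul_of_one_le_of_one_le (one_le_mul_of_one_le_of_one_le hA1 hRη1) hmi
  have hpre' : y i ≤ max A 1 * R i ^ η * m i * Real.log (max (Real.exp 1) (2 * y i)) := by
    have hX : 0 ≤ R i ^ η * m i * Real.log (max (Real.exp 1) (2 * y i)) :=
      mul_nonneg (mul_nonneg (by linarith) hm0) (by linarith)
    have h2 := mul_le_mul_of_nonneg_right (le_max_left A 1) hX
    calc y i ≤ A * R i ^ η * m i * Real.log (max (Real.exp 1) (2 * y i)) := hA i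
      _ = A * (R i ^ η * m i * Real.log (max (Real.exp 1) (2 * y i))) := by ring
      _ ≤ max A 1 * (R i ^ η * m i * Real.log (max (Real.exp 1) (2 * y i))) := h2
      _ = max A 1 * R i ^ η * m i * Real.log (max (Real.exp 1) (2 * y i)) := by ring
  have h1 := selfImprove_pow hM1 hη hη1 hpre'
  have h2 := pow_bookkeeping hA1 hRi hmi (hmR i) hη hη1
  have h3 : R i ^ (3 * η) ≤ R i ^ ε := Real.rpow_le_rpow_of_exponent_le hRi h3η
  have h8 : 0 ≤ 8 / η := by positivity
  have hA2 : 0 ≤ (max A 1) ^ 2 := sq_nonneg _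
  calc y i ≤ 8 / η * (max A 1 * R i ^ η * m i) ^ (1 + η) := h1
    _ ≤ 8 / η * ((max A 1) ^ 2 * R i ^ (3 * η) * m i) := mul_le_mul_of_nonneg_left h2 h8
    _ ≤ 8 / η * ((max A 1) ^ 2 * R i ^ ε * m i) := by
        apply mul_le_mul_of_nonneg_left _ h8
        exact mul_le_mul_of_nonneg_right (mul_le_mul_of_nonneg_left h3 hA2) hm0
    _ = 8 / η * (max A 1) ^ 2 * R i ^ ε * m i := by ring

/-! ## 2 · Objects (abbreviations only; no new notions), ring identities, the escape classification -/

/-- `Q(u,w) = u² − 11uw − w²` (norm form of the two irrational cusps of `X₁(5)`). -/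
abbrev Q (u w : ℤ) : ℤ := u ^ 2 - 11 * u * w - w ^ 2

/-- `H(u,w) = max(|u|,|w|)` as a real number. -/
abbrev H (u w : ℤ) : ℝ := max |(u : ℝ)| |(w : ℝ)|

/-- THE LINEARISED VARIABLE `y = log(13·H²)` (`≥ log 13 > 0`, `≥ log H`, and `h(ξ₀) ≤ 2y`). -/
abbrev Ylin (u w : ℤ) : ℝ := Real.log (13 * H u w ^ 2)

/-- `sign z` as a rational number. -/
abbrev sgn (z : ℤ) : ℚ := ((Int.sign z : ℤ) : ℚ)

/-- THE ONE RATIO `ξ₀ = −Q/w²` in the `approx_div` shape `ζ · (x : ℚ)/y`, `x = |Q|`, `y = |w|²`, `ζ = −sign Q`. -/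
abbrev xiU (u w : ℤ) : ℚ := (-sgn (Q u w)) * ((((Q u w).natAbs : ℕ) : ℚ) / ((w.natAbs ^ 2 : ℕ) : ℚ))

/-- `Θ₀ = theta K |Q| |w|² 0` — Pasten's `Θ` of the one ratio (only the primes of `Q` and `w`). -/
abbrev Th (K : ℝ) (u w : ℤ) : ℝ := theta K (Q u w).natAbs (w.natAbs ^ 2) 0

/-- `Y = log max(e, h(ξ₀))` — the common log-log factor of BOTH clauses of the one call. -/
abbrev Yxi (u w : ℤ) : ℝ := Real.log (max (Real.exp 1) (logHeight₁ (xiU u w)))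

/-- `R = rad(u·w·Q)` as a real number (the radical is computed in `ℤ`, then `natAbs`, then cast). -/
abbrev Rr (u w : ℤ) : ℝ := (((UniqueFactorizationMonoid.radical (u * w * Q u w)).natAbs : ℕ) : ℝ)

/-- `rad z` as a real number. -/
abbrev radR (z : ℤ) : ℝ := (((UniqueFactorizationMonoid.radical z).natAbs : ℕ) : ℝ)

/-- `T₀ : w² + Q = u(u − 11w)`, i.e. `1 − ξ₀ = u(u−11w)/w²`. -/
theorem tU (u w : ℤ) : w ^ 2 + Q u w = u * (u - 11 * w) := by
  simp only [Q]; ring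

/-- The cusp swap `(u, w) ↦ (w, −u)` negates `Q` … -/
theorem Q_swap (u w : ℤ) : Q w (-u) = -Q u w := by
  simp only [Q]; ring

/-- … and FIXES the product `u·w·Q` literally (so `rad(uwQ)` is unchanged). -/
theorem prod_swap (u w : ℤ) : w * (-u) * Q w (-u) = u * w * Q u w := by
  simp only [Q]; ring

/-- H0 (cast bookkeeping, proved): `rad z`, as a real, is the product of the rational primes of `z`. -/
theorem natAbs_radical_cast (z : ℤ) : radR z = ∏ p ∈ z.natAbs.primeFactors, (p : ℝ) := by
  simp only [radR]
  rw [← Int.radical_natAbs_eq_radical, Int.natAbs_natCast, Nat.radical_eq_prod_primeFactors, Nat.cast_prod]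

/-- H1 (proved): `1 ≤ rad z` as a real. -/
theorem one_le_radR (z : ℤ) : 1 ≤ radR z := by
  simp only [radR]
  exact_mod_cast Int.natAbs_pos.mpr (UniqueFactorizationMonoid.radical_ne_zero (a := z))

/-- H2 (proved; HARVEST of conj-k2 g4 `radR_eq`): `R = rad u · rad w · rad Q` as reals
(tree: `GoldenFromNFPencil.natAbs_radical_prod`). -/
theorem radR_prod {u w : ℤ} (h : IsCoprime u w) : Rr u w = radR u * radR w * radR (Q u w) := by
  simp only [Rr, radR, Q]
  rw [GoldenFromNFPencil.natAbs_radical_prod h]; push_cast; ring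

/-- E0 (PROVED; HARVEST verbatim of conj-k3 g2 `SanityK3G2.aux_degenerate_iff`): the two cusp
escapes `u(u − 11w) = 0` / `w(11u + w) = 0` are exactly the four unit pairs `±(11,1)`, `±(1,−11)`. -/
theorem aux_degenerate_iff (u w : ℤ) (hcop : IsCoprime u w) (h0 : u * w * (u ^ 2 - 11 * u * w - w ^ 2) ≠ 0) :
    (u * (u - 11 * w) = 0 ∨ w * (11 * u + w) = 0) ↔
      ((u = 11 ∧ w = 1) ∨ (u = -11 ∧ w = -1) ∨ (u = 1 ∧ w = -11) ∨ (u = -1 ∧ w = 11)) := by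
  have hu : u ≠ 0 := fun h => h0 (by rw [h]; ring)
  have hw : w ≠ 0 := fun h => h0 (by rw [h]; ring)
  constructor
  · rintro (h | h)
    · have h' : u = 11 * w := by
        rcases mul_eq_zero.mp h with h | h
        · exact absurd h hu
        · linarith
      have hunit : IsUnit w := by
        rw [h'] at hcop
        exact hcop.isUnit_of_dvd' (dvd_mul_left w 11) dvd_rfl
      rcases Int.isUnit_iff.mp hunit with rfl | rfl
      · left; constructor <;> omega
      · right; left; constructor <;> omega
    · have h' : w = -11 * u := by
        rcases mul_eq_zero.mp h with h | h
        · exact absurd h hw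
        · linarith
      have hunit : IsUnit u := by
        rw [h'] at hcop
        exact hcop.isUnit_of_dvd' dvd_rfl (dvd_mul_left u (-11))
      rcases Int.isUnit_iff.mp hunit with rfl | rfl
      · right; right; left; constructor <;> omega
      · right; right; right; constructor <;> omega
  · rintro (⟨rfl, rfl⟩ | ⟨rfl, rfl⟩ | ⟨rfl, rfl⟩ | ⟨rfl, rfl⟩) <;> norm_num

/-! ## 3 · FILE A (number theory, ~150 lines): the ONE call and its two clauses -/

/-- A1 (XS, proved): `ζ = −sign Q = ±1` for `Q ≠ 0`. -/
theorem neg_sgn_cases {z : ℤ} (hz : z ≠ 0) : (-sgn z = 1 ∨ -sgn z = -1) := by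
  rcases lt_or_gt_of_ne hz with h | h
  · left; simp [sgn, Int.sign_eq_neg_one_of_neg h]
  · right; simp [sgn, Int.sign_eq_one_of_pos h]

/-- A2 (XS, PROVED): `1 − ξ₀ = u(u − 11w)/w²` (`Nat.cast_natAbs`, `Int.sign_mul_abs`, `Int.cast_abs`, `sq_abs`,
`field_simp`, `push_cast [Q]`, `ring`). -/
theorem one_sub_xiU {u w : ℤ} (hw : w ≠ 0) :
    1 - xiU u w = ((u : ℚ) * (u - 11 * w)) / (w : ℚ) ^ 2 := by
  have hw' : (w : ℚ) ≠ 0 := by exact_mod_cast hw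
  have h1 : ((Int.sign (Q u w) : ℤ) : ℚ) * (((Q u w).natAbs : ℕ) : ℚ) = ((Q u w : ℤ) : ℚ) := by
    rw [Nat.cast_natAbs, ← Int.cast_mul, Int.sign_mul_abs]
  have h2 : ((w.natAbs ^ 2 : ℕ) : ℚ) = (w : ℚ) ^ 2 := by
    rw [Nat.cast_pow, Nat.cast_natAbs, Int.cast_abs, sq_abs]
  have h3 : xiU u w = -((Q u w : ℤ) : ℚ) / (w : ℚ) ^ 2 := by
    show (-sgn (Q u w)) * ((((Q u w).natAbs : ℕ) : ℚ) / ((w.natAbs ^ 2 : ℕ) : ℚ)) = _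
    rw [h2, ← h1]; simp only [sgn]; ring
  rw [h3]
  field_simp
  push_cast [Q]
  ring

/-- E1 (XS, PROVED from E0): the cusp-0 escape `u = 11w` forces `(u, w) = ±(11, 1)`, so `H = 11`. -/
theorem escape_u {u w : ℤ} (h : IsCoprime u w) (h0 : u * w * Q u w ≠ 0) (he : u - 11 * w = 0) :
    H u w = 11 := by
  have hdeg : u * (u - 11 * w) = 0 ∨ w * (11 * u + w) = 0 := Or.inl (by rw [he, mul_zero])
  rcases (aux_degenerate_iff u w h h0).mp hdeg with ⟨rfl, rfl⟩ | ⟨rfl, rfl⟩ | ⟨rfl, rfl⟩ | ⟨rfl, rfl⟩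
  · show max |((11 : ℤ) : ℝ)| |((1 : ℤ) : ℝ)| = 11
    norm_num [max_def]
  · show max |((-11 : ℤ) : ℝ)| |((-1 : ℤ) : ℝ)| = 11
    norm_num [max_def]
  · exfalso; norm_num at he
  · exfalso; norm_num at he

/-- E3 (S−): off the escape `x·y = |Q|·w² > 1`.  `|Q|·w² = 1` forces `w = ±1`, `Q = ±1`, and then
`u(u − 11w) = w² + Q ∈ {0, 2}` (`tU`): `0` is the escape (excluded by `hne`), `2 = u(u ∓ 11)` is insoluble
(`u ∣ 2`: four values, `decide`).  Alternative: `Int.natAbs_mul_self`/`Int.eq_one_or_neg_one_of_mul_eq_one'`. -/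
theorem one_lt_xy_u {u w : ℤ} (h0 : u * w * Q u w ≠ 0) (hne : u - 11 * w ≠ 0) :
    1 < (Q u w).natAbs * w.natAbs ^ 2 := by
  sorry

/-- E5 (XS, proved): `gcd(|Q|, |w|²) = 1` (`GoldenFromNFPencil.isCoprime_quadForm_right`). -/
theorem coprime_xy_u {u w : ℤ} (h : IsCoprime u w) : ((Q u w).natAbs).Coprime (w.natAbs ^ 2) := by
  have h1 : IsCoprime (Q u w) w := (GoldenFromNFPencil.isCoprime_quadForm_right h).symm
  exact (Int.isCoprime_iff_nat_coprime.mp h1).pow_right 2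

/-- E6 (XS, PROVED from A2): `ξ₀ ≠ 1` off the escape (`1 − ξ₀ = u(u−11w)/w² ≠ 0`). -/
theorem xiU_ne_one {u w : ℤ} (h0 : u * w * Q u w ≠ 0) (hne : u - 11 * w ≠ 0) : xiU u w ≠ 1 := by
  obtain ⟨huw, _⟩ := mul_ne_zero_iff.mp h0
  obtain ⟨hu, hw⟩ := mul_ne_zero_iff.mp huw
  intro h1
  have h2 := one_sub_xiU (u := u) hw
  rw [h1, sub_self] at h2
  have hw' : (w : ℚ) ≠ 0 := by exact_mod_cast hw
  have hu' : (u : ℚ) ≠ 0 := by exact_mod_cast hu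
  have hne' : (u : ℚ) - 11 * w ≠ 0 := by exact_mod_cast hne
  exact (div_ne_zero (mul_ne_zero hu' hne') (pow_ne_zero 2 hw')) h2.symm

/-- C0 (PROVED — the ONE CALL with its side conditions A1/E3/E5/E6): both clauses of
`Pasten.approx_div` for `ξ₀`, with `Θ₀ = Th K u w`; the exact term File A uses twice. -/
theorem cusp0_call {K : ℝ} (hK : 1 ≤ K) (hP : PastenApproximationBound K) {u w : ℤ}
    (h : IsCoprime u w) (h0 : u * w * Q u w ≠ 0) (hne : u - 11 * w ≠ 0) :
    (-Real.log |((1 - xiU u w : ℚ) : ℝ)| < Th K u w * Yxi u w) ∧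
    ∀ p : ℕ, p.Prime → (padicValRat p (1 - xiU u w) : ℝ) * Real.log p <
        Th K u w * ((p / Real.log p) * Real.log (max (Real.exp 1) (p * logHeight₁ (xiU u w)))) := by
  obtain ⟨huw, hQ⟩ := mul_ne_zero_iff.mp h0
  obtain ⟨_, hw⟩ := mul_ne_zero_iff.mp huw
  have hx : (Q u w).natAbs ≠ 0 := Int.natAbs_ne_zero.mpr hQ
  have hy : w.natAbs ^ 2 ≠ 0 := pow_ne_zero _ (Int.natAbs_ne_zero.mpr hw)
  exact approx_div hK hP hx hy (coprime_xy_u h) (one_lt_xy_u h0 hne) 0 (neg_sgn_cases hQ)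
    (xiU_ne_one h0 hne)

/-- P1 (S): for `p ∣ u`: `ν_p(u) ≤ ν_p(u) + ν_p(u − 11w) = ord_p(1 − ξ₀)` (`p ∤ w` by coprimality; A2,
`padicValRat.div`, `padicValRat.mul`, `padicValRat.of_int`, `padicValRat.pow`, `padicValInt` of a unit
at `p` is `0`, `Nat.factorization_def`/`padicValInt_natAbs`).  Template: k1-g4 `log_le_of_dvd_a`. -/
theorem factorization_le_padicValRat_xiU {u w : ℤ} (h : IsCoprime u w) (h0 : u * w * Q u w ≠ 0)
    (hne : u - 11 * w ≠ 0) {p : ℕ} (hp : p ∈ u.natAbs.primeFactors) :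
    ((u.natAbs.factorization p : ℕ) : ℝ) ≤ ((padicValRat p (1 - xiU u w) : ℤ) : ℝ) := by
  sorry

/-- P2 (S, generic = the divisor form of the summation inside `ThreeRoutes.log_lt_route_a`):
`log|u| = ∑_{p∣u} ν_p(u) log p` (`log_eq_sum_factorization_mul_log`) against a prime-by-prime bound
(`Finset.sum_le_sum`, `Finset.mul_sum`; the strict `<` is only used as `≤`). -/
theorem log_natAbs_le_of_padic {u : ℤ} (hu : u ≠ 0) {ξ : ℚ} {Θ : ℝ} {F : ℕ → ℝ}
    (hval : ∀ p ∈ u.natAbs.primeFactors, ((u.natAbs.factorization p : ℕ) : ℝ) ≤ ((padicValRat p (1 - ξ) : ℤ) : ℝ))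
    (hbd : ∀ p : ℕ, p.Prime → ((padicValRat p (1 - ξ) : ℤ) : ℝ) * Real.log p < Θ * F p) :
    Real.log |(u : ℝ)| ≤ Θ * ∑ p ∈ u.natAbs.primeFactors, F p := by
  sorry

/-- P3 (XS, PROVED from two tree lemmas): `(p/log p) · log max(e, p·h) ≤ 3p · log max(e, h)`. -/
theorem numerics_prime {p : ℕ} (hp : p.Prime) (h : ℝ) :
    (p : ℝ) / Real.log p * Real.log (max (Real.exp 1) (p * h)) ≤
      3 * p * Real.log (max (Real.exp 1) h) := by
  have hp1 : (1 : ℝ) ≤ p := by exact_mod_cast hp.one_lt.le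
  have hp2 : (2 : ℝ) ≤ p := by exact_mod_cast hp.two_le
  have hpl : 0 ≤ (p : ℝ) / Real.log p := div_nonneg (by linarith) (Real.log_nonneg hp1)
  calc (p : ℝ) / Real.log p * Real.log (max (Real.exp 1) (p * h))
      ≤ (p : ℝ) / Real.log p * (Real.log p + Real.log (max (Real.exp 1) h)) :=
        mul_le_mul_of_nonneg_left (log_max_exp_mul_le hp1) hpl
    _ ≤ 3 * p * Real.log (max (Real.exp 1) h) := div_log_mul_add_le hp2 (one_le_log_max_exp h)

/-- C1 (PROVED composition, p-adic clause summed over `p ∣ u`): `log|u| ≤ 3 · Θ₀ · Y · Σ_{p ∣ u} p`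
(C0.2 + P1 + P2 with `F p := 3 Y p` via P3 and `theta_nonneg`; then `Finset.mul_sum`). -/
theorem cusp0_padic {K : ℝ} (hK : 1 ≤ K) (hP : PastenApproximationBound K) {u w : ℤ}
    (h : IsCoprime u w) (h0 : u * w * Q u w ≠ 0) (hne : u - 11 * w ≠ 0) :
    Real.log |(u : ℝ)| ≤ 3 * Th K u w * Yxi u w * ∑ p ∈ u.natAbs.primeFactors, (p : ℝ) := by
  obtain ⟨huw, _⟩ := mul_ne_zero_iff.mp h0
  obtain ⟨hu, _⟩ := mul_ne_zero_iff.mp huw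
  have hC := (cusp0_call hK hP h h0 hne).2
  have hΘ : 0 ≤ Th K u w := theta_nonneg (zero_le_one.trans hK) _ _ _
  have hbd : ∀ p : ℕ, p.Prime →
      ((padicValRat p (1 - xiU u w) : ℤ) : ℝ) * Real.log p < Th K u w * (3 * Yxi u w * p) := by
    intro p hp
    have h1 := hC p hp
    have h2 := mul_le_mul_of_nonneg_left (numerics_prime hp (logHeight₁ (xiU u w))) hΘ
    have h3 : Th K u w * (3 * p * Real.log (max (Real.exp 1) (logHeight₁ (xiU u w)))) =
        Th K u w * (3 * Yxi u w * p) := by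
      simp only [Yxi]; ring
    linarith
  have key := log_natAbs_le_of_padic hu (fun p hp => factorization_le_padicValRat_xiU h h0 hne hp) hbd
  rw [← Finset.mul_sum] at key
  linarith

/-- C2 (S, the transfer inequality): `|1 − ξ₀| = |u|·|u − 11w| / w² ≤ 12|u|/|w|` when `|u| ≤ |w|`
(A2 cast to `ℝ` (`Rat.cast_div`, `Rat.cast_mul`, …); `|u − 11w| ≤ |u| + 11|w| ≤ 12|w|`; `div_le_div_iff`). -/
theorem abs_one_sub_xiU_le {u w : ℤ} (h0 : u * w * Q u w ≠ 0) (hle : |(u : ℝ)| ≤ |(w : ℝ)|) :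
    |((1 - xiU u w : ℚ) : ℝ)| ≤ 12 * |(u : ℝ)| / |(w : ℝ)| := by
  sorry

/-- C3 (S, REGIME-FREE transfer): `log H ≤ log|u| + log 12 + Θ₀ · Y`.
Case `|w| ≤ |u|`: `H = |u|` and `log 12 + Θ₀Y ≥ 0` (`theta_nonneg`, `one_le_log_max_exp`).  Case `|u| < |w|`:
`H = |w|` and C0.1 + C2: `−log(12|u|/|w|) ≤ −log|1 − ξ₀| < Θ₀Y` (`Real.log_le_log`, `|1 − ξ₀| > 0` by E6),
i.e. `log|w| < log|u| + log 12 + Θ₀Y` (`Real.log_div`, `Real.log_mul`, `|u| ≥ 1`). -/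
theorem cusp0_transfer {K : ℝ} (hK : 1 ≤ K) (hP : PastenApproximationBound K) {u w : ℤ}
    (h : IsCoprime u w) (h0 : u * w * Q u w ≠ 0) (hne : u - 11 * w ≠ 0) :
    Real.log (H u w) ≤ Real.log |(u : ℝ)| + Real.log 12 + Th K u w * Yxi u w := by
  sorry

/-- C4 (PROVED, composition of C1 and C3): the one-cusp pre-bound before absorption. -/
theorem cusp0_pre {K : ℝ} (hK : 1 ≤ K) (hP : PastenApproximationBound K) {u w : ℤ}
    (h : IsCoprime u w) (h0 : u * w * Q u w ≠ 0) (hne : u - 11 * w ≠ 0) :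
    Real.log (H u w) ≤
      Real.log 12 + Th K u w * Yxi u w * (1 + 3 * ∑ p ∈ u.natAbs.primeFactors, (p : ℝ)) := by
  have h1 := cusp0_padic hK hP h h0 hne
  have h2 := cusp0_transfer hK hP h h0 hne
  have h3 : Th K u w * Yxi u w * (1 + 3 * ∑ p ∈ u.natAbs.primeFactors, (p : ℝ)) =
      Th K u w * Yxi u w + 3 * Th K u w * Yxi u w * ∑ p ∈ u.natAbs.primeFactors, (p : ℝ) := by ring
  linarith

/-! ## 4 · FILE C, part 1 (absorption inputs): `h(ξ₀) ≤ 2y`, `Θ₀ ≤ KC·R^η`, `1 + 3Σp ≤ 4 rad u` -/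

/-- Y1 (S): `h(ξ₀) ≤ log|Q| + log w² ≤ log(13H²) + log(13H²) = 2y`
(`Pasten.logHeight₁_sign_mul_div_le hx hy hζ : h(ζ·x/y) ≤ log x + log y`; `|Q| ≤ 13H²`, `w² ≤ H² ≤ 13H²`,
`Real.log_le_log`; casts `Int.cast_natAbs`/`Nat.cast_pow`). -/
theorem logHeight₁_xiU_le {u w : ℤ} (h0 : u * w * Q u w ≠ 0) :
    logHeight₁ (xiU u w) ≤ 2 * Ylin u w := by
  sorry

/-- Y1' (XS, proved): hence `Y = log max(e, h(ξ₀)) ≤ log max(e, 2y)`. -/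
theorem Yxi_le {u w : ℤ} (h0 : u * w * Q u w ≠ 0) :
    Yxi u w ≤ Real.log (max (Real.exp 1) (2 * Ylin u w)) :=
  log_max_exp_mono (logHeight₁_xiU_le h0)

/-- T0 (S, radical bookkeeping): `rad(|Q|, |w|², |u|) = rad(u·w·Q)` as natural numbers
(`Dioph.rad a b c = (a*b*c).primeFactors.prod id`-shape: `Nat.primeFactors_mul`, `Nat.primeFactors_pow`,
`Int.natAbs_mul`, `Int.natAbs_pow`, `Int.radical_natAbs_eq_radical`, `Nat.radical_eq_prod_primeFactors`,
`Finset.union_comm`).  Template: k1-g4 `rad_xy_eq`. -/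
theorem rad_aux_eq {u w : ℤ} (h0 : u * w * Q u w ≠ 0) :
    rad (Q u w).natAbs (w.natAbs ^ 2) u.natAbs = (UniqueFactorizationMonoid.radical (u * w * Q u w)).natAbs := by
  sorry

/-- T1 (PROVED modulo T0): `Θ₀ ≤ K · C · R^η` — ONE tree call
`SingleTowerSzpiroLine.theta_zero_le_mul_rpow hK hη hC hx hy (coprime_xy_u h) (dvd_mul_right _ _) h0'` with
`(u, v, a, b, c) := (|Q|, |w|², |Q|, |w|², |u|)`, then `rad_aux_eq` and `Nat.cast` monotonicity.
Template: k1-g4 `theta_xy_le` (PROVED there modulo its `rad_xy_eq`). -/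
theorem theta_cusp0_le {K C η : ℝ} (hK : 1 ≤ K) (hη : 0 ≤ η)
    (hC : ∀ S : Finset ℕ, (∀ p ∈ S, p.Prime) → ∏ p ∈ S, K * Real.log p / (p : ℝ) ^ η ≤ C)
    {u w : ℤ} (h : IsCoprime u w) (h0 : u * w * Q u w ≠ 0) :
    Th K u w ≤ K * C * Rr u w ^ η := by
  obtain ⟨huw, hQ⟩ := mul_ne_zero_iff.mp h0
  obtain ⟨hu, hw⟩ := mul_ne_zero_iff.mp huw
  have hx : (Q u w).natAbs ≠ 0 := Int.natAbs_ne_zero.mpr hQ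
  have hy : w.natAbs ^ 2 ≠ 0 := pow_ne_zero _ (Int.natAbs_ne_zero.mpr hw)
  have h0' : (Q u w).natAbs * w.natAbs ^ 2 * u.natAbs ≠ 0 :=
    mul_ne_zero (mul_ne_zero hx hy) (Int.natAbs_ne_zero.mpr hu)
  have key := SingleTowerSzpiroLine.theta_zero_le_mul_rpow hK hη hC hx hy (coprime_xy_u h)
    (dvd_mul_right _ _) h0'
  rw [rad_aux_eq h0] at key
  exact key

/-- J3 (XS, PROVED): `1 + 3 Σ_{p ∣ u} p ≤ 4 · rad u` (tree `StewartTijdeman.sum_le_prod_of_two_le`, H0, H1). -/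
theorem one_add_three_sum_le (u : ℤ) :
    1 + 3 * ∑ p ∈ u.natAbs.primeFactors, (p : ℝ) ≤ 4 * radR u := by
  have h1 : ∑ p ∈ u.natAbs.primeFactors, (p : ℝ) ≤ radR u := by
    rw [natAbs_radical_cast]
    have h := sum_le_prod_of_two_le (s := u.natAbs.primeFactors)
      (fun p hp => (Nat.prime_of_mem_primeFactors hp).two_le)
    have h' : ((∑ p ∈ u.natAbs.primeFactors, p : ℕ) : ℝ) ≤ ((∏ p ∈ u.natAbs.primeFactors, p : ℕ) : ℝ) := by
      exact_mod_cast h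
    simpa only [Nat.cast_sum, Nat.cast_prod] using h'
  have h2 := one_le_radR u
  linarith

/-! ## 5 · FILE C, part 2: the pre-bound POINTWISE with explicit constant, the endgame call, swap, `min` -/

/-- G0 (XS, PROVED, generic real inequality = the whole "absorption" arithmetic):
from `Θ ≤ T·P`, `Y ≤ L`, `S ≤ 4m` and the signs, `a + 2ΘYS ≤ (a + 8T)·P·m·L`
(`0 ≤ Θ` is not even needed). -/
theorem absorb {a Θ T P Y L S m : ℝ} (ha : 0 ≤ a) (hΘT : Θ ≤ T * P) (hT : 0 ≤ T)
    (hP : 1 ≤ P) (hY : 0 ≤ Y) (hYL : Y ≤ L) (hL : 1 ≤ L) (hS : 0 ≤ S) (hSm : S ≤ 4 * m)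
    (hm : 1 ≤ m) :
    a + 2 * Θ * Y * S ≤ (a + 8 * T) * P * m * L := by
  have hP0 : 0 ≤ P := by linarith
  have hL0 : 0 ≤ L := by linarith
  have hm0 : 0 ≤ m := by linarith
  have hTP : 0 ≤ T * P := mul_nonneg hT hP0
  have h1 : Θ * Y ≤ T * P * L := mul_le_mul hΘT hYL hY hTP
  have h2 : Θ * Y * S ≤ T * P * L * (4 * m) := mul_le_mul h1 hSm hS (mul_nonneg hTP hL0)
  have h3 : a ≤ a * (P * m * L) := by
    have hPmL : 1 ≤ P * m * L :=
      one_le_mul_of_one_le_of_one_le (one_le_mul_of_one_le_of_one_le hP hm) hL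
    exact le_mul_of_one_le_right ha hPmL
  nlinarith [h2, h3]

/-- G1a (XS, PROVED: the escape regime): at `u = 11w` (so `(u,w) = ±(11,1)`, `H = 11`, `y = log 1573`)
the pointwise pre-bound holds for ANY `A ≥ log 1872` and `η ≥ 0` (all other factors are `≥ 1`). -/
theorem preRouteU_escape {A η : ℝ} (hA : Real.log 1872 ≤ A) (hη : 0 ≤ η) {u w : ℤ}
    (h : IsCoprime u w) (h0 : u * w * Q u w ≠ 0) (he : u - 11 * w = 0) :
    Ylin u w ≤ A * Rr u w ^ η * radR u * Real.log (max (Real.exp 1) (2 * Ylin u w)) := by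
  have hH := escape_u h h0 he
  have hy : Ylin u w = Real.log 1573 := by
    rw [show Ylin u w = Real.log (13 * H u w ^ 2) from rfl, hH]; norm_num
  have h1573 : Real.log 1573 ≤ Real.log 1872 := Real.log_le_log (by norm_num) (by norm_num)
  have hA0 : 0 ≤ A := le_trans (Real.log_nonneg (by norm_num)) hA
  have hR1 : 1 ≤ Rr u w ^ η := Real.one_le_rpow (one_le_radR _) hη
  have hm1 : 1 ≤ radR u := one_le_radR u
  have hL1 : 1 ≤ Real.log (max (Real.exp 1) (2 * Ylin u w)) := one_le_log_max_exp _
  have hyA : Ylin u w ≤ A := by rw [hy]; linarith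
  have hgrow : A ≤ A * Rr u w ^ η * radR u * Real.log (max (Real.exp 1) (2 * Ylin u w)) := by
    have e1 : A ≤ A * Rr u w ^ η := le_mul_of_one_le_right hA0 hR1
    have e2 : A * Rr u w ^ η ≤ A * Rr u w ^ η * radR u :=
      le_mul_of_one_le_right (mul_nonneg hA0 (by linarith)) hm1
    have e3 : A * Rr u w ^ η * radR u ≤
        A * Rr u w ^ η * radR u * Real.log (max (Real.exp 1) (2 * Ylin u w)) :=
      le_mul_of_one_le_right (mul_nonneg (mul_nonneg hA0 (by linarith)) (by linarith)) hL1
    linarith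
  exact hyA.trans hgrow

/-- **G1b (PROVED composition; the generic regime with EXPLICIT constant `A = log 1872 + 8KC`).**
Proof: C4 `log H ≤ log 12 + Θ₀·Yxi·(1+3Σ)`; `y = log 13 + 2 log H` (`Real.log_mul`, `Real.log_pow`, `H ≥ 1`);
so `y ≤ log 1872 + 2Θ₀·Yxi·(1+3Σ)`; then `absorb` with `a := log 1872`, `T := K·C`, `P := R^η`
(`Real.one_le_rpow`), `L := log max(e,2y)` (Y1', `one_le_log_max_exp`), `S := 1+3Σ ≤ 4 rad u` (J3),
`Θ₀ ≤ KC·R^η` (T1), `0 ≤ Θ₀` (`theta_nonneg`); finally `log 1872 ≤ log 1872 · L` etc. are inside `absorb`. -/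
theorem preRouteU_generic {K C η : ℝ} (hK : 1 ≤ K) (hP : PastenApproximationBound K) (hη : 0 < η)
    (hC1 : 1 ≤ C) (hC : ∀ S : Finset ℕ, (∀ p ∈ S, p.Prime) → ∏ p ∈ S, K * Real.log p / (p : ℝ) ^ η ≤ C)
    {u w : ℤ} (h : IsCoprime u w) (h0 : u * w * Q u w ≠ 0) (hne : u - 11 * w ≠ 0) :
    Ylin u w ≤ (Real.log 1872 + 8 * (K * C)) * Rr u w ^ η * radR u *
      Real.log (max (Real.exp 1) (2 * Ylin u w)) := by
  obtain ⟨huw, hQ⟩ := mul_ne_zero_iff.mp h0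
  obtain ⟨hu, hw⟩ := mul_ne_zero_iff.mp huw
  have hH1 : 1 ≤ H u w := by
    have : (1 : ℝ) ≤ |(u : ℝ)| := by exact_mod_cast Int.one_le_abs hu
    exact this.trans (le_max_left _ _)
  have hH0 : 0 < H u w := by linarith
  have hy : Ylin u w = Real.log 13 + 2 * Real.log (H u w) := by
    show Real.log (13 * H u w ^ 2) = _
    rw [Real.log_mul (by norm_num) (pow_ne_zero 2 hH0.ne'), Real.log_pow]; push_cast; ring
  have h1872 : Real.log 1872 = Real.log 13 + 2 * Real.log 12 := by
    rw [show (1872 : ℝ) = 13 * 12 ^ 2 by norm_num, Real.log_mul (by norm_num) (by norm_num),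
      Real.log_pow]; push_cast; ring
  have hC4 := cusp0_pre hK hP h h0 hne
  have hpre : Ylin u w ≤ Real.log 1872 +
      2 * Th K u w * Yxi u w * (1 + 3 * ∑ p ∈ u.natAbs.primeFactors, (p : ℝ)) := by
    rw [hy, h1872]; linarith
  have hT1 := theta_cusp0_le hK hη.le hC h h0
  have hKC : 0 ≤ K * C := mul_nonneg (zero_le_one.trans hK) (zero_le_one.trans hC1)
  have hP1 : 1 ≤ Rr u w ^ η := Real.one_le_rpow (one_le_radR _) hη.le
  have hY0 : 0 ≤ Yxi u w := zero_le_one.trans (one_le_log_max_exp _)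
  have hYL := Yxi_le (u := u) (w := w) h0
  have hL1 : 1 ≤ Real.log (max (Real.exp 1) (2 * Ylin u w)) := one_le_log_max_exp _
  have hS0 : 0 ≤ 1 + 3 * ∑ p ∈ u.natAbs.primeFactors, (p : ℝ) := by positivity
  have hSm := one_add_three_sum_le u
  have hm1 := one_le_radR u
  have ha : 0 ≤ Real.log 1872 := Real.log_nonneg (by norm_num)
  have key := absorb ha hT1 hKC hP1 hY0 hYL hL1 hS0 hSm hm1
  linarith

/-- G1 (PROVED from G1a + G1b): for every `η > 0` there is `A` (namely `log 1872 + 8KC_η`) with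
`y ≤ A · R^η · rad u · log max(e, 2y)` for ALL coprime `(u, w)` with `uwQ ≠ 0`. -/
theorem preRouteU {K : ℝ} (hK : 1 ≤ K) (hP : PastenApproximationBound K) {η : ℝ} (hη : 0 < η) :
    ∃ A : ℝ, ∀ u w : ℤ, IsCoprime u w → u * w * Q u w ≠ 0 →
      Ylin u w ≤ A * Rr u w ^ η * radR u * Real.log (max (Real.exp 1) (2 * Ylin u w)) := by
  obtain ⟨C, hC1, hC⟩ :=
    SingleTowerSzpiroLine.exists_prod_mul_log_div_rpow_le (A := K) (zero_le_one.trans hK) hη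
  refine ⟨Real.log 1872 + 8 * (K * C), fun u w h h0 => ?_⟩
  by_cases he : u - 11 * w = 0
  · have hKC : 0 ≤ 8 * (K * C) := by
      have hK0 : 0 ≤ K := zero_le_one.trans hK
      have hC0 : 0 ≤ C := zero_le_one.trans hC1
      positivity
    exact preRouteU_escape (by linarith) hη.le h h0 he
  · exact preRouteU_generic hK hP hη hC1 hC h h0 he

/-- The admissible pairs, as an index type for `endgame_abstract`. -/
abbrev Adm : Type := {q : ℤ × ℤ // IsCoprime q.1 q.2 ∧ q.1 * q.2 * Q q.1 q.2 ≠ 0}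

/-- G2 (XS, PROVED): on admissible pairs `0 ≤ y`, `1 ≤ R`, `1 ≤ rad u ≤ R` (H1, H2). -/
theorem adm_bounds (i : Adm) :
    0 ≤ Ylin i.1.1 i.1.2 ∧ 1 ≤ Rr i.1.1 i.1.2 ∧ 1 ≤ radR i.1.1 ∧ radR i.1.1 ≤ Rr i.1.1 i.1.2 := by
  obtain ⟨⟨u, w⟩, h, h0⟩ := i
  show 0 ≤ Ylin u w ∧ 1 ≤ Rr u w ∧ 1 ≤ radR u ∧ radR u ≤ Rr u w
  have hu : u ≠ 0 := by
    rintro rfl; exact h0 (by ring)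
  have hH1 : 1 ≤ H u w := by
    have : (1 : ℝ) ≤ |(u : ℝ)| := by exact_mod_cast Int.one_le_abs hu
    exact this.trans (le_max_left _ _)
  refine ⟨Real.log_nonneg (by nlinarith), one_le_radR _, one_le_radR _, ?_⟩
  rw [radR_prod h]
  have h1 := one_le_radR w
  have h2 := one_le_radR (Q u w)
  have h3 : 0 ≤ radR u := (zero_le_one.trans (one_le_radR u))
  calc radR u = radR u * 1 * 1 := by ring
    _ ≤ radR u * radR w * radR (Q u w) := by gcongr

/-- G3 (PROVED): `RouteU` — unpack the endgame over `Adm` and use `log H ≤ y`. -/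
theorem routeU_of_pasten {K : ℝ} (hK : 1 ≤ K) (hP : PastenApproximationBound K) : RouteU := by
  have hE := endgame_abstract (ι := Adm) (y := fun i => Ylin i.1.1 i.1.2) (R := fun i => Rr i.1.1 i.1.2)
    (m := fun i => radR i.1.1) (fun i => (adm_bounds i).1) (fun i => (adm_bounds i).2.1)
    (fun i => (adm_bounds i).2.2.1) (fun i => (adm_bounds i).2.2.2)
    (fun η hη => by
      obtain ⟨A, hA⟩ := preRouteU hK hP hη
      exact ⟨A, fun i => hA i.1.1 i.1.2 i.2.1 i.2.2⟩)
  intro ε hε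
  obtain ⟨κ, hκ⟩ := hE ε hε
  refine ⟨κ, fun u w h h0 => ?_⟩
  have key := hκ ⟨(u, w), h, h0⟩
  have hH1 : 1 ≤ H u w := by
    obtain ⟨huw, _⟩ := mul_ne_zero_iff.mp h0
    obtain ⟨hu, _⟩ := mul_ne_zero_iff.mp huw
    have : (1 : ℝ) ≤ |(u : ℝ)| := by exact_mod_cast Int.one_le_abs hu
    exact this.trans (le_max_left _ _)
  have hlog : Real.log (H u w) ≤ Ylin u w := by
    apply Real.log_le_log (by linarith)
    nlinarith
  exact hlog.trans key

/-- G4 (XS, PROVED: the cusp swap `t ↦ −1/t`): `RouteU → RouteW` by applying `RouteU` to `(w, −u)`. -/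
theorem routeW_of_routeU : RouteU → RouteW := by
  intro hU ε hε
  obtain ⟨κ, hκ⟩ := hU ε hε
  refine ⟨κ, fun u w h h0 => ?_⟩
  have h0' : w * -u * (w ^ 2 - 11 * w * -u - (-u) ^ 2) ≠ 0 := by
    have e : w * -u * (w ^ 2 - 11 * w * -u - (-u) ^ 2) = u * w * (u ^ 2 - 11 * u * w - w ^ 2) := by ring
    rw [e]; exact h0
  have key := hκ w (-u) h.symm.neg_right h0'
  have e1 : w * -u * (w ^ 2 - 11 * w * -u - (-u) ^ 2) = u * w * (u ^ 2 - 11 * u * w - w ^ 2) := by ring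
  have e2 : max |((w : ℤ) : ℝ)| |((-u : ℤ) : ℝ)| = max |((u : ℤ) : ℝ)| |((w : ℤ) : ℝ)| := by
    rw [Int.cast_neg, abs_neg, max_comm]
  rw [e1, e2] at key
  exact key

/-- R0 (XS, PROVED): the two one-cusp bounds give the min-form with `κ = max (max κ_U κ_W) 0`. -/
theorem cuspMinRadBound_of_routes : RouteU → RouteW → CuspMinRadBound := by
  intro hU hW ε hε
  obtain ⟨κ₁, h₁⟩ := hU ε hε
  obtain ⟨κ₂, h₂⟩ := hW ε hε
  refine ⟨max (max κ₁ κ₂) 0, fun u w h h0 => ?_⟩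
  have a₁ := h₁ u w h h0
  have a₂ := h₂ u w h h0
  generalize hP : (((UniqueFactorizationMonoid.radical (u * w * (u ^ 2 - 11 * u * w - w ^ 2))).natAbs : ℕ) : ℝ)
      ^ (ε : ℝ) = P at *
  generalize ha : (((UniqueFactorizationMonoid.radical u).natAbs : ℕ) : ℝ) = a at *
  generalize hb : (((UniqueFactorizationMonoid.radical w).natAbs : ℕ) : ℝ) = b at *
  have hP0 : 0 ≤ P := by rw [← hP]; positivity
  have ha0 : 0 ≤ a := by rw [← ha]; positivity
  have hb0 : 0 ≤ b := by rw [← hb]; positivity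
  have hk0 : 0 ≤ max (max κ₁ κ₂) 0 := le_max_right _ _
  have hk1 : κ₁ ≤ max (max κ₁ κ₂) 0 := (le_max_left _ _).trans (le_max_left _ _)
  have hk2 : κ₂ ≤ max (max κ₁ κ₂) 0 := (le_max_right _ _).trans (le_max_left _ _)
  rcases min_choice a b with hm | hm <;> rw [hm]
  · calc Real.log (max |(u : ℝ)| |(w : ℝ)|) ≤ κ₁ * P * a := a₁
      _ ≤ max (max κ₁ κ₂) 0 * P * a :=
          mul_le_mul_of_nonneg_right (mul_le_mul_of_nonneg_right hk1 hP0) ha0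
  · calc Real.log (max |(u : ℝ)| |(w : ℝ)|) ≤ κ₂ * P * b := a₂
      _ ≤ max (max κ₁ κ₂) 0 * P * b :=
          mul_le_mul_of_nonneg_right (mul_le_mul_of_nonneg_right hk2 hP0) hb0

/-- Cover lemma (PROVED; HARVEST verbatim of conj-k2 g4 `min_le_geom`): `min a b ≤ a^s b^t`, `s + t = 1`. -/
theorem min_le_geom {a b s t : ℝ} (ha : 0 ≤ a) (hb : 0 ≤ b) (hs : 0 ≤ s) (ht : 0 ≤ t)
    (hst : s + t = 1) : min a b ≤ a ^ s * b ^ t := by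
  have hm0 : 0 ≤ min a b := le_min ha hb
  have hsplit : min a b = (min a b) ^ s * (min a b) ^ t := by
    rw [← Real.rpow_add' hm0 (by rw [hst]; norm_num), hst, Real.rpow_one]
  rw [hsplit]
  exact mul_le_mul (Real.rpow_le_rpow hm0 (min_le_left a b) hs)
    (Real.rpow_le_rpow hm0 (min_le_right a b) ht) (Real.rpow_nonneg hm0 t) (Real.rpow_nonneg ha s)

/-- Cover lemma (PROVED; HARVEST verbatim of conj-k2 g4 `min_le_sqrt_mul`): `min a b ≤ (ab)^{1/2}`. -/
theorem min_le_sqrt_mul {a b : ℝ} (ha : 0 ≤ a) (hb : 0 ≤ b) :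
    min a b ≤ (a * b) ^ (1 / 2 : ℝ) := by
  have h := min_le_geom ha hb (s := 1 / 2) (t := 1 / 2) (by norm_num) (by norm_num) (by norm_num)
  rwa [← Real.mul_rpow ha hb] at h

/-- Endgame cover (PROVED; HARVEST verbatim of conj-k2 g4 `exp_step`): from `L ≤ κ R^ε · X` with
`0 ≤ X ≤ R^θ` conclude `L ≤ max κ 0 · R^{θ+ε}`. -/
theorem exp_step {L κ R X ε θ : ℝ} (hR : 0 ≤ R) (hX0 : 0 ≤ X) (hL : L ≤ κ * R ^ (ε : ℝ) * X)
    (hX : X ≤ R ^ θ) (hθε : θ + ε ≠ 0) : L ≤ max κ 0 * R ^ (θ + ε : ℝ) := by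
  have hRe : 0 ≤ R ^ (ε : ℝ) := Real.rpow_nonneg hR _
  calc L ≤ κ * R ^ (ε : ℝ) * X := hL
    _ ≤ max κ 0 * R ^ (ε : ℝ) * X :=
        mul_le_mul_of_nonneg_right (mul_le_mul_of_nonneg_right (le_max_left _ _) hRe) hX0
    _ ≤ max κ 0 * R ^ (ε : ℝ) * R ^ θ :=
        mul_le_mul_of_nonneg_left hX (mul_nonneg (le_max_right _ _) hRe)
    _ = max κ 0 * R ^ (θ + ε : ℝ) := by
        rw [mul_assoc, ← Real.rpow_add' hR (by rwa [add_comm] at hθε), add_comm]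

/-- R1 (XS, PROVED): min-form ⇒ STUB (`min a b ≤ (ab)^{1/2} ≤ (ab)^{2/3}` as `ab ≥ 1`; `1 ≤ q^{1/3}`). -/
theorem stubSplit_of_cuspMinRadBound : CuspMinRadBound → StubSplit := by
  intro hM ε hε
  obtain ⟨κ, hκ⟩ := hM ε hε
  refine ⟨max κ 0, fun u w h h0 => ?_⟩
  have A := hκ u w h h0
  have ha1 : (1 : ℝ) ≤ (((UniqueFactorizationMonoid.radical u).natAbs : ℕ) : ℝ) := one_le_radR u
  have hb1 : (1 : ℝ) ≤ (((UniqueFactorizationMonoid.radical w).natAbs : ℕ) : ℝ) := one_le_radR w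
  have hq1 : (1 : ℝ) ≤ (((UniqueFactorizationMonoid.radical (u ^ 2 - 11 * u * w - w ^ 2)).natAbs : ℕ) : ℝ) :=
    one_le_radR _
  generalize hP : (((UniqueFactorizationMonoid.radical (u * w * (u ^ 2 - 11 * u * w - w ^ 2))).natAbs : ℕ) : ℝ)
      ^ (ε : ℝ) = P at *
  generalize hq : (((UniqueFactorizationMonoid.radical (u ^ 2 - 11 * u * w - w ^ 2)).natAbs : ℕ) : ℝ) = q at *
  generalize ha : (((UniqueFactorizationMonoid.radical u).natAbs : ℕ) : ℝ) = a at *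
  generalize hb : (((UniqueFactorizationMonoid.radical w).natAbs : ℕ) : ℝ) = b at *
  have hP0 : 0 ≤ P := by rw [← hP]; positivity
  have ha0 : 0 ≤ a := by linarith
  have hb0 : 0 ≤ b := by linarith
  have hab1 : 1 ≤ a * b := one_le_mul_of_one_le_of_one_le ha1 hb1
  have hX : min a b ≤ (a * b) ^ (2 / 3 : ℝ) * q ^ (1 / 3 : ℝ) := by
    calc min a b ≤ (a * b) ^ (1 / 2 : ℝ) := min_le_sqrt_mul ha0 hb0
      _ ≤ (a * b) ^ (2 / 3 : ℝ) := Real.rpow_le_rpow_of_exponent_le hab1 (by norm_num)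
      _ ≤ (a * b) ^ (2 / 3 : ℝ) * q ^ (1 / 3 : ℝ) :=
          le_mul_of_one_le_right (Real.rpow_nonneg (mul_nonneg ha0 hb0) _) (Real.one_le_rpow hq1 (by norm_num))
  calc Real.log (max |(u : ℝ)| |(w : ℝ)|) ≤ κ * P * min a b := A
    _ ≤ max κ 0 * P * min a b :=
        mul_le_mul_of_nonneg_right (mul_le_mul_of_nonneg_right (le_max_left _ _) hP0) (le_min ha0 hb0)
    _ ≤ max κ 0 * P * ((a * b) ^ (2 / 3 : ℝ) * q ^ (1 / 3 : ℝ)) :=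
        mul_le_mul_of_nonneg_left hX (mul_nonneg (le_max_right _ _) hP0)

/-- R2 (XS, PROVED; adapted from conj-k2 g4 `crux_of_uwHalf`): min-form ⇒ CRUX BY NAME
(`min(rad u, rad w) ≤ (rad u · rad w)^{1/2} ≤ R^{1/2}` by H2; `R^ε · R^{1/2} = R^{1/2+ε}` via `exp_step`). -/
theorem goldenCuspShadow_of_cuspMinRadBound :
    CuspMinRadBound → Summit.ABC.ABC.Theses.CuspFieldPencil.GoldenCuspShadow := by
  intro hM ε hε
  obtain ⟨κ, hκ⟩ := hM ε hε
  refine ⟨max κ 0, fun u w h h0 => ?_⟩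
  have A := hκ u w h h0
  have hprod : (((UniqueFactorizationMonoid.radical (u * w * (u ^ 2 - 11 * u * w - w ^ 2))).natAbs : ℕ) : ℝ) =
      (((UniqueFactorizationMonoid.radical u).natAbs : ℕ) : ℝ) *
        (((UniqueFactorizationMonoid.radical w).natAbs : ℕ) : ℝ) *
        (((UniqueFactorizationMonoid.radical (u ^ 2 - 11 * u * w - w ^ 2)).natAbs : ℕ) : ℝ) := radR_prod h
  have hq1 : (1 : ℝ) ≤ (((UniqueFactorizationMonoid.radical (u ^ 2 - 11 * u * w - w ^ 2)).natAbs : ℕ) : ℝ) :=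
    one_le_radR _
  generalize hR : (((UniqueFactorizationMonoid.radical (u * w * (u ^ 2 - 11 * u * w - w ^ 2))).natAbs : ℕ) : ℝ)
      = R at *
  generalize hq : (((UniqueFactorizationMonoid.radical (u ^ 2 - 11 * u * w - w ^ 2)).natAbs : ℕ) : ℝ) = q at *
  generalize ha : (((UniqueFactorizationMonoid.radical u).natAbs : ℕ) : ℝ) = a at *
  generalize hb : (((UniqueFactorizationMonoid.radical w).natAbs : ℕ) : ℝ) = b at *
  have ha0 : 0 ≤ a := by rw [← ha]; exact Nat.cast_nonneg _
  have hb0 : 0 ≤ b := by rw [← hb]; exact Nat.cast_nonneg _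
  have hR0 : 0 ≤ R := by rw [← hR]; exact Nat.cast_nonneg _
  have hab : a * b ≤ R := by
    rw [hprod]
    have : 0 ≤ a * b := mul_nonneg ha0 hb0
    nlinarith
  have hX : min a b ≤ R ^ (1 / 2 : ℝ) :=
    (min_le_sqrt_mul ha0 hb0).trans (Real.rpow_le_rpow (mul_nonneg ha0 hb0) hab (by norm_num))
  exact exp_step hR0 (le_min ha0 hb0) A hX (by linarith)

/-! ## 6 · Assembly (sorry-free): helpers ⇒ RouteU ⇒ RouteW ⇒ min-form ⇒ stub and crux, UNCONDITIONALLY -/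

/-- `RouteU` holds outright: the input `∃ K ≥ 1, PastenApproximationBound K` is the kernel theorem
`approximationBound_rat_holds` (route YuMatveevShapeRat, closed·proved). -/
theorem routeU_holds : RouteU := by
  obtain ⟨K, hK, hP⟩ := approximationBound_rat_holds
  exact routeU_of_pasten hK hP

/-- `RouteW` by the cusp swap. -/
theorem routeW_holds : RouteW :=
  routeW_of_routeU routeU_holds

/-- The min-form. -/
theorem cuspMinRadBound_holds : CuspMinRadBound :=
  cuspMinRadBound_of_routes routeU_holds routeW_holds

/-- THE STUB, modulo the sorried helpers only.  Land it with the VERBATIM registered header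
`theorem stub_splitCuspTriple : <payload signature> := stubSplit_holds` (`--supports stmt-ABC-26026`). -/
theorem stubSplit_holds : StubSplit :=
  stubSplit_of_cuspMinRadBound cuspMinRadBound_holds

/-- THE CRUX `GoldenCuspShadow` BY NAME, modulo the sorried helpers only (audit: proof-of-item). -/
theorem goldenCuspShadow_holds : Summit.ABC.ABC.Theses.CuspFieldPencil.GoldenCuspShadow :=
  goldenCuspShadow_of_cuspMinRadBound cuspMinRadBound_holds

/-! ## 7 · Unit tests of the side conditions at the extremal / degenerate pairs (kernel-checked) -/

/-- The escape pair `(11, 1)`: `u − 11w = 0`, `Q = −1`, `|Q|·w² = 1` (so `approx_div` is NOT called there);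
`y = log(13·121) = log 1573 < log 1872 ≤ A`. -/
example : Q 11 1 = -1 ∧ (11 : ℤ) - 11 * 1 = 0 ∧ (13 : ℤ) * 11 ^ 2 = 1573 ∧ (1573 : ℤ) < 13 * 12 ^ 2 := by decide

/-- Off the escape `x·y = |Q|·w² > 1` already at the smallest pairs. -/
example : Q 1 1 = -11 ∧ Q 1 (-1) = 11 ∧ Q 2 1 = -19 ∧ Q 12 1 = 11 ∧ Q 11 (-1) = 241 := by decide

/-- The swap is `t ↦ −1/t` on the level of `Q`, and `(1, −11)` is the cusp-∞ escape. -/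
example : Q 1 (-11) = -Q 11 1 ∧ (1 : ℤ) - 11 * (-11) ≠ 0 ∧ (-11 : ℤ) - 11 * (-1) = 0 := by decide

/-- E3's residual equation `u(u ∓ 11) = 2` has no solution with `u ∣ 2`. -/
example : ∀ u ∈ ({1, -1, 2, -2} : Finset ℤ), u * (u - 11) ≠ 2 ∧ u * (u + 11) ≠ 2 := by decide

/-- `|Q| ≤ 13 H²` in the small cases. -/
example : (Q 1 (-1)).natAbs ≤ 13 * 1 ^ 2 ∧ (Q 3 (-2)).natAbs ≤ 13 * 3 ^ 2 := by decide

end Summit.ABC.ABC.Cruxes.GoldenCuspShadow.SplitK2G6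

end
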